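import Summits.ResolutionOfSingularities.ResolutionOfSingularities.Theses.Descent
import Literature.AlgebraicGeometry.Resolution.KollarMaxContactChartsFieldChange
import Literature.AlgebraicGeometry.Resolution.RegularDerivationQuotient
import Literature.AlgebraicGeometry.Resolution.PowerSeriesRegularLocal
import Literature.AlgebraicGeometry.Resolution.CompletedPullbackRegular
import Mathlib.FieldTheory.RatFunc.Basic
import HarnessLib

/-!
# p-generic specialisation of regularity (PGS) and the decision of c8's Question Q2
# — crux workfile for `Theses.Descent.DescentPerfectToAll` (stmt-ResolutionOfSingularities-0549), lens 4, gen 6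

[OURS · CANDIDATE] counted 0; nothing here proves resolution in char p. This file types (and, where cheap,
PROVES over the tree) the one positive specialisation principle found by seat res-B-lens-4 gen 6 and the
matching negative example; it is a TOOL / OBSTRUCTION record on the crux, not a line: no `DescentPerfectToAll_of`
is claimed (see §5 of the module docstring and the memo `PGENERIC-SPECIALISATION-lens4-g6.md`).

## §1 PGS (proved). Transversal ARITHMETIC derivation ⇒ the fibre is a regular hypersurface.
Let `R → S`, `R → A` be commutative rings, `B = S ⊗_R A` a pushout (`Algebra.IsPushout R S A B`), `δ ∈ Der_R(A)`
with `δ b` a unit (`b ∈ A` "p-generic over `R`"), `t ∈ S`. Then for `f := t ⊗ 1 − 1 ⊗ b ∈ B`: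
* `f ∉ 𝔮⁽²⁾` for every prime `𝔮 ∋ f` of `B` (`specialisation_mul_not_mem_sq`);
* `B` regular ⇒ `B/(f)` regular (`isRegularRing_quotient_specialisation`);
* pointwise: `B_𝔮` regular local ⇒ `B_𝔮/(f)` regular local of dimension `dim B_𝔮 − 1`
  (`isRegularLocalRing_quotient_specialisation_atPrime`).
Proof: the base-changed derivation `δ_B = id_S ⊗ δ` (tree: `Derivation.baseChangeOfIsPushout`) kills `S ∋ t` and sends
`f` to the unit `−δ b`; Stacks 07PF (tree: `isRegularRing_quotient_of_derivation`, `not_mem_sq_of_derivation_unit`).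
PROVENANCE: this is Zariski's MIXED Jacobian criterion — Matsumura, Commutative Ring Theory, Thm. 30.5 (2)⇒(1)
(held copy PDF p. 252): "for any p-basis `{u_γ}` of `k` define `D_γ ∈ Der(S)` by `D_γ(u_γ') = δ_γγ'`, `D_γ(X_i) = 0`" —
specialised to the arithmetic derivations alone; the `n`-coordinate version (`b ∈ Kⁿ` p-independent over `K₀`,
`det(D_i f_j) = ±1`) is the tree's `Literature.AlgebraicGeometry.Resolution.Matsumura1987_30_4` applied to the `D_i`.
Nothing in §1 is new as commutative algebra; new is only its USE on rung B (§3–§5).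
Geometric reading: `R = K₀ ⊆ A = K` fields of char `p`, `S = 𝒪(𝒴₀)` for a `K₀`-scheme `𝒴₀` with a coordinate
`t : 𝒴₀ → 𝔸¹_{K₀}`, `B = 𝒪(𝒴₀ ⊗_{K₀} K)`; `b ∈ K` with `db ≠ 0` in `Ω_{K/K₀}` (⟺ `b ∉ K^p·K₀` ⟺ a dual derivation
exists): the fibre `𝒴_b = {t = b}` of the REGULAR `K`-scheme `𝒴` is regular wherever `𝒴` is. Iterating coordinate by
coordinate (`K₀ ↦ K₀(b₁)` etc.) gives the version for `b ∈ Kⁿ` p-independent over `K₀`.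

## §2 Scope remark (no new class over perfect `K₀`).
With `K₀` perfect and `b` p-independent in `K`, PGS is exactly the tree engine
`Theorems.hasResolution_pullback_of_linearIndepOn_pow` (exhaustion). The new use is `K₀` IMPERFECT finitely generated
(the field of definition of a spread-out family) and `K` of infinite relative p-rank (`InfinitePRank`, §4).

## §3 Q2⁻ (the negative half; algebra proved in the digit-≤-1 case, general case in the memo).
Over any field `κ` of char `p` and `q, c₀, c₁ ∈ κ`: `x^p + q z^p + (c₀^p + q c₁^p) = (x + c₀)^p + q (z + c₁)^p ∈ 𝔪_P^p ⊆ 𝔪_P²`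
at `P = (x + c₀, z + c₁)` (`fermatForm_mem_sq`), hence `V(x^p + q z^p + c)` is SINGULAR at `P`
(`not_isRegularLocalRing_fermatForm`). CURVE LEMMA (memo §3, paper proof by the conductor index `det M(z)`): for
`q ∉ κ^p`, `V(x^p + q z^p + c) ⊂ 𝔸²_κ` is regular ⟺ `c ∉ κ^p(q)`. Consequently, for a field `k` with `[k : k^p] = p`
and p-basis `{q}`, the smooth `k`-family `Y = Bl_{V(y′, x^p + q z^p + t)}(𝔸³ × 𝔸¹_t) → 𝔸¹_t` — a birational modification
of the CONSTANT family `𝔸³ × 𝔸¹` with regular generic fibre — has a SINGULAR fibre over every closed point with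
separable residue field, and regular fibres exactly over the p-generic (necessarily inseparable, e.g. `(t^p − q)`) points.

## §4 Typed statements for provers (defs of `Prop`, no proofs claimed here).
`InfinitePRank K`; `PurelyTranscendentalDescent p` («`[K:K^p] = ∞` ⇒ Res(X_{K(t)}) ⇒ Res(X)»);
`AffineLineDescent p` («`[K:K^p] = ∞` ⇒ Res(X × 𝔸¹_K) ⇒ Res(X)»); `CurveLemma p`; `QTwoSeparableNegative p`.
Paper proofs: memo §2–§3 (spreading out, openness of `Reg` on excellent schemes, Nagata compactification, PGS,
constancy of `(f^*H)^d` in flat families).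

## §5 Why this is not a line on the crux (honest scope).
PGS needs p-generic POINTS over the family's field of definition: they exist iff the relative p-rank is `≥ dim A`;
the residual core of rung B in finite p-rank (Laurent slice `k((s))`, countable digit hulls with `K_def ∋` p-basis)
has relative p-rank `0`, and there PGS-specialisation lands in INSEPARABLE residue fields, i.e. in the one-root step
F″ ≡ crux (`descentPerfectToAll_iff_oneRootStepCore`). In infinite relative p-rank a SOURCE of `Res(X_L)` for a
separable, p-generically populated `L/K` is missing: exhaustion is excluded by Theorem D (gen 3,
`SeparableInvarianceOfExhaustion`), ultraproducts of f.g. levels need c8-N3 (c1) uniformity AND p-genericity IN `K`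
of Łoś-specialised points, which Łoś cannot certify across the inseparable `K/K_j`. So: Q2 is decided, obstacle (c2)
of c8-N3 is dissolved in infinite relative p-rank and confirmed (sharply) in p-rank 1; obstacle (c1) stands.

Sources: StacksProject 07PF/07PG; Matsumura1987 Thm 14.2, §26 (p-bases ↔ derivations), Thm 30.4; EGAIV2 6.7.4, 6.12
(openness of Reg for excellent schemes); Kollar2007 1.19; Liu2002 Ex. 7.3.15; MacLane 1939 (p-independence);
tree: `Literature.Barriers.ResolutionOfSingularities.{InseparableBaseChange, RegularNotGeometricallyRegular}`,
`Cruxes/DescentPerfectToAll/NegativeNotes-independent-pass-c8.md` (N3, Q2).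
-/

noncomputable section

set_option linter.dupNamespace false

open IsLocalRing TensorProduct AlgebraicGeometry CategoryTheory
open Literature.AlgebraicGeometry.Resolution

namespace Summit.ResolutionOfSingularities.ResolutionOfSingularities.Cruxes.DescentPerfectToAll.PGeneric

universe u

/-! ## §1 PGS: specialisation at a point detected by a derivation of the constants -/

section PGS

variable (R S A B : Type*) [CommRing R] [CommRing S] [Algebra R S] [CommRing A] [CommRing B]
  [Algebra R A] [Algebra R B] [Algebra A B] [Algebra S B] [IsScalarTower R A B]
  [IsScalarTower R S B] [Algebra.IsPushout R S A B]

/-- The specialising equation `t ⊗ 1 − 1 ⊗ b` of the fibre `{t = b}` inside `B = S ⊗_R A`. [folklore] -/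
def specialisingElt (t : S) (b : A) : B := algebraMap S B t - algebraMap A B b

/-- The base-changed derivation `δ_B = id_S ⊗ δ` sends `t ⊗ 1 − 1 ⊗ b` to `−(δ b)`: it kills the coordinate `t ∈ S`
and differentiates the constant `b ∈ A`. [folklore] -/
theorem baseChangeDeriv_specialisingElt (δ : Derivation R A A) (t : S) (b : A) :
    Derivation.baseChangeOfIsPushout R S A B δ (specialisingElt S A B t b) =
      -algebraMap A B (δ b) := by
  unfold specialisingElt
  rw [map_sub, Derivation.map_algebraMap, Derivation.baseChangeOfIsPushout_algebraMap, zero_sub]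

/-- If `δ b` is a unit (`b` p-generic over `R`), then `δ_B (t ⊗ 1 − 1 ⊗ b)` is a unit modulo `t ⊗ 1 − 1 ⊗ b`
(indeed a unit of `B`). [folklore] -/
theorem isUnit_mk_baseChangeDeriv_specialisingElt (δ : Derivation R A A) (t : S) (b : A)
    (hb : IsUnit (δ b)) :
    IsUnit (Ideal.Quotient.mk (Ideal.span {specialisingElt S A B t b})
      (Derivation.baseChangeOfIsPushout R S A B δ (specialisingElt S A B t b))) := by
  rw [baseChangeDeriv_specialisingElt]
  exact ((hb.map (algebraMap A B)).neg).map _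

/-- **PGS, symbolic-square form.** If `δ b` is a unit for some `δ ∈ Der_R(A)`, then `t ⊗ 1 − 1 ⊗ b ∉ 𝔮⁽²⁾` for
every prime `𝔮 ∋ t ⊗ 1 − 1 ⊗ b` of `B = S ⊗_R A`: no `u ∉ 𝔮` has `u·(t ⊗ 1 − 1 ⊗ b) ∈ 𝔮²`.
[cite: StacksProject, Tag 07PF] -/
theorem specialisation_mul_not_mem_sq (δ : Derivation R A A) (t : S) (b : A) (hb : IsUnit (δ b))
    (Q : Ideal B) [Q.IsPrime] (hfQ : specialisingElt S A B t b ∈ Q) {u : B} (hu : u ∉ Q) :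
    u * specialisingElt S A B t b ∉ Q ^ 2 :=
  not_mem_sq_of_derivation_unit (specialisingElt S A B t b) (Derivation.baseChangeOfIsPushout R S A B δ)
    (isUnit_mk_baseChangeDeriv_specialisingElt R S A B δ t b hb) Q hfQ hu

/-- **PGS, global form.** `B = S ⊗_R A` regular, `δ ∈ Der_R(A)` with `δ b` a unit ⇒ the fibre ring
`B/(t ⊗ 1 − 1 ⊗ b)` is regular, for every `t ∈ S`. [cite: StacksProject, Tag 07PF] -/
theorem isRegularRing_quotient_specialisation [IsRegularRing B] (δ : Derivation R A A) (t : S) (b : A)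
    (hb : IsUnit (δ b)) :
    IsRegularRing (B ⧸ Ideal.span {specialisingElt S A B t b}) :=
  isRegularRing_quotient_of_derivation (specialisingElt S A B t b)
    (Derivation.baseChangeOfIsPushout R S A B δ) (isUnit_mk_baseChangeDeriv_specialisingElt R S A B δ t b hb)

/-- **PGS, pointwise form.** At a prime `𝔮 ∋ f := t ⊗ 1 − 1 ⊗ b` of `B = S ⊗_R A` with `B_𝔮` regular local, and
`δ b` a unit for some `δ ∈ Der_R(A)`: `f ∈ 𝔮B_𝔮 ∖ 𝔮²B_𝔮`, so `B_𝔮/(f)` is regular local and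
`dim B_𝔮/(f) + 1 = dim B_𝔮` («the fibre `{t = b}` is regular at every point where the total space is»).
[cite: Matsumura1987, Thm. 14.2] [cite: StacksProject, Tag 07PF] -/
theorem isRegularLocalRing_quotient_specialisation_atPrime (δ : Derivation R A A) (t : S) (b : A)
    (hb : IsUnit (δ b)) (Q : Ideal B) [Q.IsPrime] (hfQ : specialisingElt S A B t b ∈ Q)
    [IsRegularLocalRing (Localization.AtPrime Q)] :
    IsRegularLocalRing (Localization.AtPrime Q ⧸
        Ideal.span {algebraMap B (Localization.AtPrime Q) (specialisingElt S A B t b)}) ∧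
      ringKrullDim (Localization.AtPrime Q ⧸
        Ideal.span {algebraMap B (Localization.AtPrime Q) (specialisingElt S A B t b)}) + 1 =
        ringKrullDim (Localization.AtPrime Q) := by
  set f := specialisingElt S A B t b with hf
  have hfm : algebraMap B (Localization.AtPrime Q) f ∈ maximalIdeal (Localization.AtPrime Q) := by
    rw [← Localization.AtPrime.map_eq_maximalIdeal]
    exact Ideal.mem_map_of_mem _ hfQ
  have hfm2 : algebraMap B (Localization.AtPrime Q) f ∉ maximalIdeal (Localization.AtPrime Q) ^ 2 := by
    rw [← Localization.AtPrime.map_eq_maximalIdeal, ← Ideal.map_pow,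
      IsLocalization.algebraMap_mem_map_algebraMap_iff Q.primeCompl]
    rintro ⟨u, hu, huf⟩
    exact specialisation_mul_not_mem_sq R S A B δ t b hb Q hfQ hu huf
  exact IsRegularLocalRing.quotient_span_singleton hfm hfm2

end PGS

/-! ## §2 p-generic points: the hypothesis `IsUnit (δ b)` in field terms -/

section PGeneric

/-- `b ∈ K` is **p-generic over `K₀`**: some `K₀`-derivation of `K` takes a unit (WLOG the value `1`) on `b`.
For fields of characteristic `p` this is `db ≠ 0` in `Ω_{K/K₀}`, i.e. `b ∉ K^p·K₀`, i.e. `{b}` extends to a p-basis of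
`K` over `K₀` (Matsumura §26, Thm. 26.5–26.8; Mac Lane 1939). [cite: Matsumura1987, Thm. 26.5] -/
def IsPGenericOver (K₀ K : Type*) [CommRing K₀] [CommRing K] [Algebra K₀ K] (b : K) : Prop :=
  ∃ δ : Derivation K₀ K K, IsUnit (δ b)

/-- A field `K` has **infinite p-rank relative to every finitely generated subfield**: for every finite set `s ⊆ K`
there are `b ∈ K` and a derivation of `K` killing `s` with `δ b = 1` (for `char K = p`: `[K : K^p] = ∞`; then p-generic
elements over any finitely generated `K₀ ⊆ K` exist and are Zariski dense in every `𝔸ⁿ(K)`, `n ≥ 1`, by translation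
with `(K^p K₀)ⁿ`). [cite: Matsumura1987, Thm. 26.5] -/
def InfinitePRank (K : Type*) [CommRing K] : Prop :=
  ∀ s : Finset K, ∃ (b : K) (δ : Derivation ℤ K K), (∀ x ∈ s, δ x = 0) ∧ δ b = 1

/-- PGS restated with `IsPGenericOver`: over a p-generic point the fibre ring of a regular base change is regular.
[cite: StacksProject, Tag 07PF] -/
theorem isRegularRing_quotient_of_isPGenericOver (R S A B : Type*) [CommRing R] [CommRing S] [Algebra R S]
    [CommRing A] [CommRing B] [Algebra R A] [Algebra R B] [Algebra A B] [Algebra S B] [IsScalarTower R A B]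
    [IsScalarTower R S B] [Algebra.IsPushout R S A B] [IsRegularRing B] (t : S) {b : A}
    (hb : IsPGenericOver R A b) :
    IsRegularRing (B ⧸ Ideal.span {specialisingElt S A B t b}) := by
  obtain ⟨δ, hδ⟩ := hb
  exact isRegularRing_quotient_specialisation R S A B δ t b hδ

end PGeneric

/-! ## §3 Q2⁻: the purely inseparable form `x^p + q z^p + c` is singular when `c ∈ κ^p + q κ^p` -/

section QTwoNegative

variable {κ : Type u} [Field κ] (p : ℕ) [hp : Fact p.Prime] [CharP κ p]

/-- The plane curve equation `F_{q,c} = x^p + q z^p + c ∈ κ[x, z]` (`x = X 0`, `z = X 1`). [folklore] -/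
def fermatForm (q c : κ) : MvPolynomial (Fin 2) κ :=
  MvPolynomial.X 0 ^ p + MvPolynomial.C q * MvPolynomial.X 1 ^ p + MvPolynomial.C c

/-- The maximal ideal `(x + c₀, z + c₁)` of the `κ`-point `(−c₀, −c₁)`. [folklore] -/
def pointIdeal (c₀ c₁ : κ) : Ideal (MvPolynomial (Fin 2) κ) :=
  Ideal.span {MvPolynomial.X 0 + MvPolynomial.C c₀, MvPolynomial.X 1 + MvPolynomial.C c₁}

/-- Digit expansion: if `c = c₀^p + q c₁^p` then `x^p + q z^p + c = (x + c₀)^p + q (z + c₁)^p` (Frobenius is additive).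
[folklore] -/
theorem fermatForm_eq_of_digits (q c₀ c₁ : κ) :
    fermatForm p q (c₀ ^ p + q * c₁ ^ p) =
      (MvPolynomial.X 0 + MvPolynomial.C c₀) ^ p +
        MvPolynomial.C q * (MvPolynomial.X 1 + MvPolynomial.C c₁) ^ p := by
  unfold fermatForm
  rw [add_pow_char (MvPolynomial.X (0 : Fin 2)) (MvPolynomial.C (σ := Fin 2) c₀) p,
    add_pow_char (MvPolynomial.X (1 : Fin 2)) (MvPolynomial.C (σ := Fin 2) c₁) p,
    ← MvPolynomial.C_pow, ← MvPolynomial.C_pow, map_add, map_mul, MvPolynomial.C_pow, MvPolynomial.C_pow]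
  ring

/-- `x^p + q z^p + (c₀^p + q c₁^p) ∈ (x + c₀, z + c₁)^p ⊆ (x + c₀, z + c₁)²`: the curve passes through the rational point
`(−c₀, −c₁)` with multiplicity `p ≥ 2`. [folklore] -/
theorem fermatForm_mem_sq (q c₀ c₁ : κ) :
    fermatForm p q (c₀ ^ p + q * c₁ ^ p) ∈ pointIdeal c₀ c₁ ^ 2 := by
  have hp2 : 2 ≤ p := hp.out.two_le
  refine Ideal.pow_le_pow_right hp2 ?_
  rw [fermatForm_eq_of_digits]
  refine Ideal.add_mem _ (Ideal.pow_mem_pow (Ideal.subset_span (by simp)) p)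
    (Ideal.mul_mem_left _ _ (Ideal.pow_mem_pow (Ideal.subset_span (by simp)) p))

omit [CharP κ p] in
/-- `F_{q,c} ≠ 0`: its `x^p`-coefficient is `1`. [folklore] -/
theorem fermatForm_ne_zero (q c : κ) : fermatForm p q c ≠ 0 := by
  have hp0 : p ≠ 0 := hp.out.ne_zero
  intro h
  have hc := congrArg (MvPolynomial.coeff (Finsupp.single (0 : Fin 2) p)) h
  have h10 : (Finsupp.single (1 : Fin 2) p : Fin 2 →₀ ℕ) ≠ Finsupp.single 0 p := by
    intro h'
    have := Finsupp.single_left_injective hp0 h'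
    exact absurd this (by decide)
  have h0 : (0 : Fin 2 →₀ ℕ) ≠ Finsupp.single 0 p := by
    intro h'
    have := congrArg (fun f => f 0) h'
    simp at this
    exact hp0 this.symm
  simp [fermatForm, MvPolynomial.coeff_X_pow, MvPolynomial.coeff_C_mul, MvPolynomial.coeff_C, h10, h0] at hc

/-- **Q2⁻ (digit case, proved): `V(x^p + q z^p + c)` is singular at `(−c₀, −c₁)` when `c = c₀^p + q c₁^p`.**
For every prime `P` of the coordinate ring `κ[x,z]/(F)` lying at that point (i.e. whose preimage contains `x + c₀`
and `z + c₁`), the local ring is not regular. Over a field of p-rank `1` with p-basis `{q}` EVERY `c` has this shape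
after an inseparable point is allowed (memo §3, curve lemma); for `c ∈ κ^p + q κ^p` the singular point is rational.
[cite: Matsumura1987, Thm. 14.2] -/
theorem not_isRegularLocalRing_fermatForm (q c₀ c₁ : κ)
    (P : Ideal (MvPolynomial (Fin 2) κ ⧸ Ideal.span {fermatForm p q (c₀ ^ p + q * c₁ ^ p)})) [P.IsPrime]
    (hP : pointIdeal c₀ c₁ ≤ P.comap (Ideal.Quotient.mk _)) :
    ¬ IsRegularLocalRing (Localization.AtPrime P) :=
  not_isRegularLocalRing_localization_quotient_of_mem_sq (fermatForm_ne_zero p q _) P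
    (Ideal.pow_right_mono hP 2 (fermatForm_mem_sq p q c₀ c₁))

end QTwoNegative

/-! ## §4 Typed statements (paper-proved in the memo; for provers; nothing here is asserted) -/

section Statements

/-- **Curve lemma** (memo §3): over a field `κ` of characteristic `p` with `q ∉ κ^p`, the affine curve
`V(x^p + q z^p + c)` is regular iff `c ∉ κ^p(q) = ⊕_{i<p} κ^p q^i`. (⇐: a derivation `D` with `D q = 0`, `D c = 1`
and Stacks 07PF; ⇒: over `κ(q^{1/p})` the curve is a `p`-fold line and `κ[C] ⊂ κ(q^{1/p})[z]` has nonconstant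
conductor index `det M(z) = z^{p(p-1)/2} + …`.) Typed as: regularity of the coordinate RING. [folklore] -/
def CurveLemma (p : ℕ) [Fact p.Prime] : Prop :=
  ∀ (κ : Type) [Field κ] [CharP κ p] (q c : κ), (∀ y : κ, y ^ p ≠ q) →
    (IsRegularRing (MvPolynomial (Fin 2) κ ⧸ Ideal.span {fermatForm p q c}) ↔
      ¬ ∃ v : Fin p → κ, c = ∑ i, v i ^ p * q ^ (i : ℕ))

/-- **Q2⁻, separable points, p-rank one** (memo §3): if `{q}` is a p-basis of `κ` (every element is `Σ v_i^p q^i`),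
then for EVERY `c ∈ κ` the curve `V(x^p + q z^p + c)` — the singular locus of the fibre `Bl_{V(y′, x^p+qz^p+c)} 𝔸³_κ`
of the model family — is not regular. (p-bases pass to finite separable extensions, so this covers every closed point
of `𝔸¹_k` with separable residue field when `[k : k^p] = p`.) [folklore] -/
def QTwoSeparableNegative (p : ℕ) [Fact p.Prime] : Prop :=
  ∀ (κ : Type) [Field κ] [CharP κ p] (q : κ), (∀ y : κ, y ^ p ≠ q) →
    (∀ c : κ, ∃ v : Fin p → κ, c = ∑ i, v i ^ p * q ^ (i : ℕ)) →
      ∀ c : κ, ¬ IsRegularRing (MvPolynomial (Fin 2) κ ⧸ Ideal.span {fermatForm p q c})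

/-- **Purely transcendental descent in infinite p-rank** (memo §2, Cor. (ii)): for a field `K` of characteristic `p`
with `[K : K^p] = ∞` and a separated `K`-scheme `X` of finite type, a resolution of `X ×_K K(t)` yields one of `X`
(spread over `U ⊆ 𝔸¹_K`, `Reg` open on the excellent total space, PGS at a p-generic `K`-point of `U`, birationality
by flatness). [folklore] -/
def PurelyTranscendentalDescent (p : ℕ) : Prop :=
  ∀ (K : Type) [Field K] [CharP K p], InfinitePRank K →
    ∀ (X : Scheme.{0}) (f : X ⟶ Spec (.of K)), IsSeparated f → LocallyOfFiniteType f → QuasiCompact f →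
      IsReduced X → Scheme.HasResolution (Limits.pullback f (specOfAlgebra K (RatFunc K))) →
        Scheme.HasResolution X

/-- **`𝔸¹`-descent in infinite p-rank** (memo §2, Cor. (iii)): `Res(X × 𝔸¹_K) ⇒ Res(X)` for `[K : K^p] = ∞`
(PGS at a p-generic `K`-point of `𝔸¹`; the converse holds over any field). [folklore] -/
def AffineLineDescent (p : ℕ) : Prop :=
  ∀ (K : Type) [Field K] [CharP K p], InfinitePRank K →
    ∀ (X : Scheme.{0}) (f : X ⟶ Spec (.of K)), IsSeparated f → LocallyOfFiniteType f → QuasiCompact f →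
      IsReduced X → Scheme.HasResolution (Limits.pullback f (specOfAlgebra K (Polynomial K))) →
        Scheme.HasResolution X

end Statements

end Summit.ResolutionOfSingularities.ResolutionOfSingularities.Cruxes.DescentPerfectToAll.PGeneric
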